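import Mathlib
import HarnessLib

/-!
# Crux C1 `MainConjectureTransportAlignedAtTwo` (stmt-BirchSwinnertonDyer-22296), line `birth`, residual (R2) = the Kilford stratum:
# PARITY SWITCH versus «same ρ̄-plane» — the two abstract lemmas behind the third-engine memo `THIRD-ENGINE-3431-att-p5-g17.md` §4
# (width seat att-p5 g17; `--supports 22296`)

THEOREMS ONLY (no `def`, no `sorry`, no named fact; elementary group theory + `decide` over `𝔽₂`). BSD is not proved by this; C1 is not
closed by this.

Context. On the Kilford stratum `J₀(N)[𝔪] ≅ ρ̄ ⊗ U` (`U ≅ 𝔽₂²`, multiplicity two) carries THREE `Γ_ℚ`-stable ρ̄-planes (copies `ρ̄ ⊗ w`,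
`w ∈ U ∖ 0`; in the tree's matrix model of `F1Sign2.CopyAlignmentAtTwo`: the copy `{a·wᵀ : a ∈ ρ̄}`), and the (R2) residual of C1 needs
«`AlignedAtTwo` ⟹ the two optimal curves occupy the SAME copy» (att-p3 g15's `hCopyN`, -imc's H12♯). Cremona–Mazur (2000) Table 2 lists two
«parity switch» rows — optimal `E, F` of the same conductor, opposite signs `ε_N(E) ≠ ε_N(F)` of the Atkin–Lehner involution `w_N`, with
«`E[2] = F[2]` in `J₀(N)`» (their condition (5)); the third engine finds (5) TRUE at 3995 (a ~ d) and FALSE at 3431 (a, b, c pairwise distinct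
planes). The two lemmas here are the structure behind that split:
* §1 **`exists_two_torsion_sub_eq_of_paritySwitch`** — in any abelian group `J` with an endomorphism `w`, if `w = 1` on a subgroup `A`, `w = −1`
  on a subgroup `B`, and the `2`-torsion of `A` and of `B` is `2`-divisible inside `A`, `B` (abelian varieties), then every `y ∈ A ∩ B` with
  `2y = 0` is `(w − 1)z` for some `z ∈ J[2]` («the common plane of a parity-switched pair lies in `(w_N − 1)J[2] ⊆ J⁺ ∩ J⁻`»); hence
  **`eq_zero_of_paritySwitch_of_fix_two_torsion`**: if `w` fixes `J[2]` pointwise, a parity-switched pair has `A[2] ∩ B[2] = 0`.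
* §2 the `𝔽₂` core (all by `decide`): **`mulVec_eq_self_unique_of_involution_ne_one`** — an involution `u ≠ 1` of `𝔽₂²` fixes exactly ONE
  non-zero vector; **`copy_stable_iff_mulVec_eq_self`** — the copy `ρ̄ ⊗ w` is stable under `1 ⊗ u` iff `u w = w`; hence
  **`copies_eq_of_stable_of_involution_ne_one`**: if `w̄_N = 1 ⊗ u` with `u ≠ 1` (a transvection) then ALL `w̄_N`-stable occupied copies
  coincide (the 3995 mechanism: `rank(w̄_N − 1 | J[𝔪]) = 2`, one occupied plane), while `u = 1` imposes nothing (3431: three occupied planes);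
  and **`vecMulVec_eq_vecMulVec_imp`** — two copies meet only in `0` unless equal (so congruence mod `2` of ANY primitive homology datum of two
  curves — plus line, minus line, period functional — forces equal planes: Cremona–Mazur's «first strategy» is sound when run in `H₁(X₀(N),ℤ)`).

References: Cremona–Mazur, Exp. Math. 9 (2000) §3 condition (5), p. 10 Remark, Table 2 notes 4–6 [CremonaMazur2000]; Kilford–Wiese, Exp. Math. 17
(2008) Thm. 1.3, Question 1.9 [KilfordWiese2008]; Darmon–Diamond–Taylor 1995 §1.7 [DarmonDiamondTaylor1995].
-/

-- justification: the `Summit.BirchSwinnertonDyer.BirchSwinnertonDyer.…` path repeats a component (route-file convention)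
set_option linter.dupNamespace false
set_option autoImplicit false

namespace Summit.BirchSwinnertonDyer.BirchSwinnertonDyer.Theorems.AlignedTransportAtTwoParitySwitchPlanes

/-! ## §1 Parity switch: the common `2`-torsion of a `w = +1` subgroup and a `w = −1` subgroup lies in `(w − 1)·J[2]` -/

section ParitySwitch

variable {J : Type*} [AddCommGroup J]

/-- **Parity-switch lemma (4-torsion argument).** `w` an additive endomorphism of `J`, `A, B ≤ J` with `w = 1` on `A` and `w = −1` on `B`,
and `2`-divisibility of the `2`-torsion inside `A` and inside `B` (as for the `ℚ̄`-points of abelian subvarieties). Then every common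
`2`-torsion element `y ∈ A ∩ B` is of the form `w z − z` with `2z = 0`: pick `2x = y` in `A`, `2x' = y` in `B`, `z := x − x'`; then
`2z = 0` and `w z − z = (x + x') − (x − x') = 2x' = y`. (Cremona–Mazur p. 10: for odd `p` the signs are read off `E[p] = F[p]`; at `p = 2`
this is what survives.) [cite: CremonaMazur2000, §3 condition (5) and p. 10 Remark] -/
theorem exists_two_torsion_sub_eq_of_paritySwitch (w : J →+ J) {A B : AddSubgroup J}
    (hA : ∀ a ∈ A, w a = a) (hB : ∀ b ∈ B, w b = -b)
    (hdivA : ∀ y ∈ A, 2 • y = 0 → ∃ x ∈ A, 2 • x = y) (hdivB : ∀ y ∈ B, 2 • y = 0 → ∃ x ∈ B, 2 • x = y)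
    {y : J} (hyA : y ∈ A) (hyB : y ∈ B) (hy : 2 • y = 0) :
    ∃ z : J, 2 • z = 0 ∧ w z - z = y := by
  obtain ⟨x, hxA, hx⟩ := hdivA y hyA hy
  obtain ⟨x', hxB, hx'⟩ := hdivB y hyB hy
  refine ⟨x - x', ?_, ?_⟩
  · rw [smul_sub, hx, hx', sub_self]
  · rw [map_sub, hA x hxA, hB x' hxB]
    -- x - (-x') - (x - x') = 2 • x' = y
    rw [← hx', two_nsmul]
    abel

/-- **Corollary: no parity switch on a common plane when `w` fixes `J[2]`.** If moreover `w z = z` for every `z` with `2z = 0`, then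
`A ∩ B` has no non-zero `2`-torsion: a parity-switched pair of optimal curves cannot share a non-zero `2`-torsion point, let alone its
plane `E[2]`, inside a `J` whose `2`-torsion is fixed by `w_N`. [cite: CremonaMazur2000, §3 condition (5)] -/
theorem eq_zero_of_paritySwitch_of_fix_two_torsion (w : J →+ J) {A B : AddSubgroup J}
    (hA : ∀ a ∈ A, w a = a) (hB : ∀ b ∈ B, w b = -b)
    (hdivA : ∀ y ∈ A, 2 • y = 0 → ∃ x ∈ A, 2 • x = y) (hdivB : ∀ y ∈ B, 2 • y = 0 → ∃ x ∈ B, 2 • x = y)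
    (hfix : ∀ z : J, 2 • z = 0 → w z = z)
    {y : J} (hyA : y ∈ A) (hyB : y ∈ B) (hy : 2 • y = 0) : y = 0 := by
  obtain ⟨z, hz2, hz⟩ := exists_two_torsion_sub_eq_of_paritySwitch w hA hB hdivA hdivB hyA hyB hy
  rw [← hz, hfix z hz2, sub_self]

/-- The element `z` of the parity-switch lemma is moved by `w`: `w z ≠ z` as soon as `y ≠ 0` — i.e. a parity-switched pair sharing a
non-zero `2`-torsion point forces `w̄ ≠ 1` on `J[2]` (the «transvection» side of the dichotomy; 3995 in the third-engine census).
[cite: CremonaMazur2000, Table 2 note 6] -/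
theorem exists_two_torsion_ne_of_paritySwitch (w : J →+ J) {A B : AddSubgroup J}
    (hA : ∀ a ∈ A, w a = a) (hB : ∀ b ∈ B, w b = -b)
    (hdivA : ∀ y ∈ A, 2 • y = 0 → ∃ x ∈ A, 2 • x = y) (hdivB : ∀ y ∈ B, 2 • y = 0 → ∃ x ∈ B, 2 • x = y)
    {y : J} (hyA : y ∈ A) (hyB : y ∈ B) (hy : 2 • y = 0) (hy0 : y ≠ 0) :
    ∃ z : J, 2 • z = 0 ∧ w z ≠ z := by
  obtain ⟨z, hz2, hz⟩ := exists_two_torsion_sub_eq_of_paritySwitch w hA hB hdivA hdivB hyA hyB hy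
  refine ⟨z, hz2, fun h => hy0 ?_⟩
  rw [← hz, h, sub_self]

end ParitySwitch

/-! ## §2 The `𝔽₂` core: involutions of the multiplicity space `U = 𝔽₂²` and the copies `ρ̄ ⊗ w = {a·wᵀ}` -/

section F2Core

open Matrix

/-- An involution `u ≠ 1` of `𝔽₂²` (necessarily a transvection) fixes at most ONE non-zero vector: two non-zero fixed vectors coincide.
(`w̄_N = 1 ⊗ u` on `J₀(N)[𝔪] = ρ̄ ⊗ U`; every occupied copy `ρ̄ ⊗ w` is `w̄_N`-stable, i.e. `u w = w`.) [folklore] -/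
theorem mulVec_eq_self_unique_of_involution_ne_one_aux :
    ∀ u : Matrix (Fin 2) (Fin 2) (ZMod 2), ∀ w w' : Fin 2 → ZMod 2,
      (u * u = 1 ∧ u ≠ 1 ∧ w ≠ 0 ∧ w' ≠ 0 ∧ u.mulVec w = w ∧ u.mulVec w' = w') → w = w' := by
  decide

/-- Curried form of `mulVec_eq_self_unique_of_involution_ne_one_aux`: an involution `u ≠ 1` of `𝔽₂²` fixes at most one non-zero
vector. [folklore] -/
theorem mulVec_eq_self_unique_of_involution_ne_one
    (u : Matrix (Fin 2) (Fin 2) (ZMod 2)) (hu : u * u = 1) (hu1 : u ≠ 1)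
    (w w' : Fin 2 → ZMod 2) (hw : w ≠ 0) (hw' : w' ≠ 0) (h : u.mulVec w = w) (h' : u.mulVec w' = w') : w = w' :=
  mulVec_eq_self_unique_of_involution_ne_one_aux u w w' ⟨hu, hu1, hw, hw', h, h'⟩

/-- Such an involution DOES fix a non-zero vector (so exactly one): the transvection case is never empty. [folklore] -/
theorem exists_mulVec_eq_self_of_involution :
    ∀ u : Matrix (Fin 2) (Fin 2) (ZMod 2), u * u = 1 → ∃ w : Fin 2 → ZMod 2, w ≠ 0 ∧ u.mulVec w = w := by
  decide

/-- **Stability of a copy under `1 ⊗ u`.** For an involution `u` of `U` and `w ≠ 0`, the copy `ρ̄ ⊗ w = {a·wᵀ}` is mapped into itself by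
`a·wᵀ ↦ a·(u w)ᵀ` iff `u w = w`. [folklore] -/
theorem copy_stable_iff_mulVec_eq_self :
    ∀ u : Matrix (Fin 2) (Fin 2) (ZMod 2), u * u = 1 → ∀ w : Fin 2 → ZMod 2, w ≠ 0 →
      ((∀ a : Fin 2 → ZMod 2, ∃ a' : Fin 2 → ZMod 2, vecMulVec a (u.mulVec w) = vecMulVec a' w) ↔ u.mulVec w = w) := by
  decide

/-- **Two copies meet only in `0` unless they are equal**: `a·wᵀ = a'·w'ᵀ` with `w, w' ≠ 0` forces `a = 0` (hence `a' = 0`) or `w = w'`.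
So a non-zero common vector of two copies — e.g. congruent plus-lines, minus-lines or period functionals mod `2` of two optimal curves in
`H₁(X₀(N),ℤ)` — forces the SAME plane (Cremona–Mazur's first strategy is sound in the true homology). [cite: CremonaMazur2000, §3 (first strategy)] -/
theorem vecMulVec_eq_vecMulVec_imp_aux :
    ∀ w w' a a' : Fin 2 → ZMod 2, (w ≠ 0 ∧ w' ≠ 0 ∧ vecMulVec a w = vecMulVec a' w') → (a = 0 ∨ w = w') := by
  decide

/-- Curried form of `vecMulVec_eq_vecMulVec_imp_aux`: two copies `ρ̄ ⊗ w`, `ρ̄ ⊗ w'` meet only in `0` unless `w = w'`. [folklore] -/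
theorem vecMulVec_eq_vecMulVec_imp (w w' : Fin 2 → ZMod 2) (hw : w ≠ 0) (hw' : w' ≠ 0) (a a' : Fin 2 → ZMod 2)
    (h : vecMulVec a w = vecMulVec a' w') : a = 0 ∨ w = w' :=
  vecMulVec_eq_vecMulVec_imp_aux w w' a a' ⟨hw, hw', h⟩

/-- **The transvection side of the dichotomy.** If `u` is an involution `≠ 1` of the multiplicity space and two occupied copies `ρ̄ ⊗ w`,
`ρ̄ ⊗ w'` are both stable under `1 ⊗ u`, then `w = w'`: ALL `w̄_N`-stable copies coincide — whatever the Atkin–Lehner signs of the curves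
(third-engine census: `rank(w̄_N − 1 | J₀(3995)[𝔪]) = 2` and 3995a1, 3995d1 share their plane; at 3431 `u = 1` and the three curves occupy
the three distinct planes). [cite: CremonaMazur2000, Table 2 notes 4 and 6] [cite: KilfordWiese2008, Question 1.9] -/
theorem copies_eq_of_stable_of_involution_ne_one (u : Matrix (Fin 2) (Fin 2) (ZMod 2)) (hu : u * u = 1) (hu1 : u ≠ 1)
    (w w' : Fin 2 → ZMod 2) (hw : w ≠ 0) (hw' : w' ≠ 0)
    (hst : ∀ a : Fin 2 → ZMod 2, ∃ a' : Fin 2 → ZMod 2, vecMulVec a (u.mulVec w) = vecMulVec a' w)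
    (hst' : ∀ a : Fin 2 → ZMod 2, ∃ a' : Fin 2 → ZMod 2, vecMulVec a (u.mulVec w') = vecMulVec a' w') : w = w' :=
  mulVec_eq_self_unique_of_involution_ne_one u hu hu1 w w' hw hw'
    ((copy_stable_iff_mulVec_eq_self u hu w hw).1 hst) ((copy_stable_iff_mulVec_eq_self u hu w' hw').1 hst')

end F2Core

/-! ## §3 The intersection of a parity-switched pair is `2`-torsion, and «same plane ⟺ the whole plane is common» -/

section Intersection

variable {J : Type*} [AddCommGroup J]

/-- **A parity-switched pair meets only in `2`-torsion.** If `w = 1` on `A` and `w = −1` on `B` then every `y ∈ A ∩ B` satisfies `2y = 0`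
(`y = w y = −y`). Hence for optimal curves `E, F` of opposite Atkin–Lehner sign, `E^∨ ∩ F^∨ ⊆ E^∨[2] ∩ F^∨[2]` is killed by `2`
(`|E^∨ ∩ F^∨| ∈ {1, 2, 4}`), and «`E[2] = F[2]` in `J₀(N)`» (Cremona–Mazur's (5) at `p = 2`) is the same as «`|E^∨ ∩ F^∨| = 4`»: no deeper
congruence (mod `4`, …) can glue a parity-switched pair. (Third-engine census: `|∩| = 4` at 3995 a~d and 10913 b~d, b~e; `|∩| ≤ 2` for the
20 parity-switched pairs at the eleven other levels, in particular at 3431.) [cite: CremonaMazur2000, §3 condition (5) and p. 10 Remark] -/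
theorem two_smul_eq_zero_of_paritySwitch (w : J →+ J) {A B : AddSubgroup J}
    (hA : ∀ a ∈ A, w a = a) (hB : ∀ b ∈ B, w b = -b) {y : J} (hyA : y ∈ A) (hyB : y ∈ B) : 2 • y = 0 := by
  have h1 := hA y hyA
  have h2 := hB y hyB
  rw [h1] at h2
  -- y = -y
  rw [two_nsmul]
  nth_rewrite 1 [h2]
  exact neg_add_cancel y

/-- The intersection of a parity-switched pair, spelled out: `y ∈ A ⊓ B` iff `y ∈ A`, `y ∈ B` and `2y = 0` — so «`E[2] = F[2]` in
`J₀(N)`» for optimal curves of opposite sign is equivalent to «`E^∨ ∩ F^∨` has order `4`» (it is always a subgroup of the plane `E^∨[2]`):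
the census quantity `dim(K_E ∩ K_F) ∈ {0,1,2}` is `log₂ |E^∨ ∩ F^∨|`. [cite: CremonaMazur2000, §3 condition (5)] -/
theorem mem_inf_iff_of_paritySwitch (w : J →+ J) {A B : AddSubgroup J}
    (hA : ∀ a ∈ A, w a = a) (hB : ∀ b ∈ B, w b = -b) (y : J) :
    y ∈ A ⊓ B ↔ (y ∈ A ∧ y ∈ B ∧ 2 • y = 0) := by
  constructor
  · intro hy
    have h := AddSubgroup.mem_inf.mp hy
    exact ⟨h.1, h.2, two_smul_eq_zero_of_paritySwitch w hA hB h.1 h.2⟩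
  · rintro ⟨hyA, hyB, -⟩
    exact AddSubgroup.mem_inf.mpr ⟨hyA, hyB⟩

end Intersection

end Summit.BirchSwinnertonDyer.BirchSwinnertonDyer.Theorems.AlignedTransportAtTwoParitySwitchPlanes
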